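import Literature.NumberTheory.LFunctions.Zhang2022.RepairTentProfile
import Literature.NumberTheory.LFunctions.Zhang2022.RepairPairFormGram
import Literature.NumberTheory.LFunctions.Zhang2022.RepairGluedForm

/-!
# The cross slot of the structural barrier (K-S3): `𝔡 + 𝔡′` of a design is the polar form `P(𝔤_θ, f_θ)`

Trunk T-ANT (NumberTheory/LFunctions). Repair rung F-S1R (D-0077) for Y. Zhang, *Discrete mean estimates and
the Landau–Siegel zero*, arXiv:2211.02515v1 [Zhang2022LandauSiegel] — **an unrefereed manuscript under
adjudication; nothing here asserts any of its claims.** Structural route (lead ruling R3, `repair/p4/Q2-ARCHITECTURE.md`),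
item K-S3: the cross main term `Ξ₁* = Σ𝔠*(H₁J̄₁ + H̄₂J₂)ω` of (2.17)/(10.1),

  `Ξ₁* = Θ₁(𝐚₁₁,𝐚₁₃) + conj Θ₁(𝐚₁₃,𝐚₂₁) + Θ₁(𝐚₁₄,𝐚₂₂) + conj Θ₁(𝐚₁₂,𝐚₁₄) + o(𝔓)` (10.1),

evaluated at main order by the manuscript's own rule (Proposition 7.1 with Lemmas 8.2/8.4/10.1/10.2 = formula I,
the sesquilinear form `Mform` of `RepairFormulaIGram`), as a functional of the design `θ`, and its identification
with the polar main-term form on the design's profiles — the hypotheses `hd`, `hdp` of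
`RepairStructuralBarrierBlocks.not_repairable_true_need_of_blocks` and `hsum` of
`RepairStructuralBarrier.not_repairable_true_need_of_dictionary`.

* `dSum1S θ = M(g₁, f) + conj M(f, g₁)` — formula I on `Θ₁(𝐚₁₁,𝐚₁₃) + conj Θ₁(𝐚₁₃,𝐚₂₁)`: `g₁ = h1Profile θ`
  (`H₁ = H₁₁ + ι₂H₁₂`), `f = tentT θ` (`J₁`); **`dSum1S_eq_polar : dSum1S θ = P(g₁, f)`** (= `hd`).
* `dSum2S θ = M(f₂, g₂) + conj M(g₂, f₂)` — formula I on `Θ₁(𝐚₁₄,𝐚₂₂) + conj Θ₁(𝐚₁₂,𝐚₁₄)`: `g₂ = h2Profile θ`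
  (`H₂`'s profile `ῑ₄ϰ₂ + ῑ₃ϰ₃`, `𝐚₂₂ = conj 𝐚₁₂`), `f₂` the profile of `J₂` = the REFLECTED tent
  (`[1−ν₁, 1−ν₂]`, (2.30) with §12's reflection, ties of record) = the tent of the reflected design
  `θ.reflectJ` (`tentT_reflectJ : tentT θ.reflectJ = R̃(tentT θ)`); **`dSum2S_eq_polar : dSum2S θ = P(R̃g₂, f)`**
  (= `hdp`; route: `P(R̃g₂, f) = conj P(g₂, R̃f)` (`mainTermFormPolar_refl`) `= P(f₂, g₂) = M(f₂,g₂) + conj M(g₂,f₂)`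
  (Gram identity on the one-sided pair `f₂, g₂`), with the derivative companion of `R̃f` corrected on the three
  kinks by `mainTermFormPolar_congr_ae`).
* `dSumS θ = dSum1S θ + dSum2S θ` — the functional of record for `(𝔡 + 𝔡′)(θ)`; **`dSumS_eq_polar :
  dSumS θ = P(g₁ + R̃g₂, f)`** (= `hsum`, via `RepairGluedForm.polar_add_refl_left`).

The companion file `RepairCrossFormSection10` identifies `dSum1S`, `dSum2S` with the TRANSCRIBED §10 functionals
of `RepairSection10Theta` (`Σ_j W_j(d₃ⱼ + d̄₄ⱼ)`, `Σ_j W_j(d′₅ⱼ + d₅ⱼ + conj(d′₆ⱼ + d₆ⱼ))`) on the face `ν₂ = 1/2` of the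
class, where the printed shapes are exact. Domain here: `AdmissibleTheta θ`. No statement about Theorems 1–2.
-/

noncomputable section

open Complex Real ComplexConjugate MeasureTheory Set intervalIntegral
open scoped Interval

namespace Literature.NumberTheory.LFunctions.Zhang2022

namespace Repair

variable {θ : Theta}

/-! ### The reflected design: `J₂`'s tent is the tent of `θ.reflectJ` -/

/-- the design with the tent window reflected: `(ν₁, ν₂) ↦ (1 − ν₂, 1 − ν₁)`, everything else unchanged —
`J₂ = [1−ν₁, 1−ν₂]` is `J₁` of `θ.reflectJ` (same `σ`, `h`; peak `mid₂ = 1 − mid₁`).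
[cite: Zhang2022LandauSiegel, (2.30) p.10, §12 (12.6)–(12.8)] -/
def Theta.reflectJ (θ : Theta) : Theta := { θ with nu1 := 1 - θ.nu2, nu2 := 1 - θ.nu1 }

/-- [cite: Zhang2022LandauSiegel, (2.30) p.10] -/ @[simp] theorem reflectJ_nu1 (θ : Theta) : θ.reflectJ.nu1 = 1 - θ.nu2 := rfl
/-- [cite: Zhang2022LandauSiegel, (2.30) p.10] -/ @[simp] theorem reflectJ_nu2 (θ : Theta) : θ.reflectJ.nu2 = 1 - θ.nu1 := rfl
/-- [cite: Zhang2022LandauSiegel, (2.30) p.10] -/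
@[simp] theorem reflectJ_hw (θ : Theta) : θ.reflectJ.hw = θ.hw := by
  unfold Theta.hw; simp only [reflectJ_nu1, reflectJ_nu2]; ring
/-- [cite: Zhang2022LandauSiegel, (2.30) p.10] -/
@[simp] theorem reflectJ_sig (θ : Theta) : θ.reflectJ.sig = θ.sig := by
  unfold Theta.sig; simp only [reflectJ_nu1, reflectJ_nu2]; ring
/-- [cite: Zhang2022LandauSiegel, (2.30) p.10] -/
@[simp] theorem reflectJ_mid1 (θ : Theta) : θ.reflectJ.mid1 = θ.mid2 := by
  unfold Theta.mid2 Theta.mid1; simp only [reflectJ_nu1, reflectJ_nu2]; ring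
/-- [cite: Zhang2022LandauSiegel, (2.30) p.10] -/
theorem reflectJ_lt (h : θ.nu2 < θ.nu1) : θ.reflectJ.nu2 < θ.reflectJ.nu1 := by simp; linarith
/-- reflecting twice is the identity. [cite: Zhang2022LandauSiegel, (2.30) p.10] -/
@[simp] theorem Theta.reflectJ_reflectJ (θ : Theta) : θ.reflectJ.reflectJ = θ := by
  cases θ; simp [Theta.reflectJ]

/-- **the profile of `J₂` is the reflected tent**: `tentT θ.reflectJ = R̃(tentT θ)` (as functions).
[cite: Zhang2022LandauSiegel, (2.30) p.10, §12 (12.6)–(12.8)] -/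
theorem tentT_reflectJ (θ : Theta) : tentT θ.reflectJ = reflProfile (tentT θ) := by
  funext y
  simp only [tentT, reflProfile, Complex.conj_ofReal, tentR, reflectJ_sig, reflectJ_hw, reflectJ_mid1]
  unfold Theta.mid2
  rw [show |y - (1 - θ.mid1)| = |1 - y - θ.mid1| from by rw [← abs_neg]; congr 1; ring]

/-- and reflecting back: `R̃(tentT θ.reflectJ) = tentT θ`. [cite: Zhang2022LandauSiegel, (2.30) p.10] -/
theorem reflProfile_tentT_reflectJ (θ : Theta) : reflProfile (tentT θ.reflectJ) = tentT θ := by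
  rw [tentT_reflectJ, reflProfile_reflProfile]

/-- `𝔶𝔶₁ⱼ` of the reflected design is the reflected-tent polynomial `yy1rT` of `RepairSection10Theta`.
[cite: Zhang2022LandauSiegel, §10 p.57] -/
theorem yy1T_reflectJ (θ : Theta) (j : ℕ) : yy1T θ.reflectJ j = yy1rT θ j := by
  funext z; unfold yy1T yy1rT Theta.nu1pp Theta.hi2; simp only [reflectJ_nu1, reflectJ_nu2, reflectJ_mid1]

/-- `𝔶𝔶₂ⱼ` of the reflected design is `yy2rT`. [cite: Zhang2022LandauSiegel, §10 p.57] -/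
theorem yy2T_reflectJ (θ : Theta) (j : ℕ) : yy2T θ.reflectJ j = yy2rT θ j := by
  funext z; unfold yy2T yy2rT Theta.hi2; simp only [reflectJ_nu1]

/-- the reflected-tent derivative companion `R̃′(tentT′ θ)` agrees with the right derivative of the reflected
design's tent off the three kinks `{1−ν₁, mid₂, 1−ν₂}` — hence almost everywhere on `(0,1]`.
[cite: Zhang2022LandauSiegel, (2.30) p.10] -/
theorem reflDeriv_tentT'_ae (h : θ.nu2 < θ.nu1) :
    ∀ᵐ x ∂volume, x ∈ Ι (0:ℝ) 1 → reflDeriv (tentT' θ) x = tentT' θ.reflectJ x := by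
  have hm := θ.mid1_eq; have hn := θ.nu1_eq; have hp := θ.hw_pos h
  have hr := reflectJ_lt h
  have hm' : θ.reflectJ.mid1 = 1 - θ.mid1 := by rw [reflectJ_mid1]; rfl
  filter_upwards [MeasureTheory.Measure.ae_ne volume (1 - θ.nu1),
    MeasureTheory.Measure.ae_ne volume (1 - θ.mid1), MeasureTheory.Measure.ae_ne volume (1 - θ.nu2)]
    with x hx1 hxm hx2 _
  simp only [reflDeriv]
  rcases lt_or_gt_of_ne hx1 with h1 | h1
  · -- x < 1 − ν₁ : below the reflected tent; 1 − x > ν₁ above the original tent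
    rw [tentT'_of_lt_lo (θ := θ.reflectJ) (by simpa using h1), tentT'_of_hi_le h (by linarith)]; simp
  rcases lt_or_gt_of_ne hxm with h2 | h2
  · -- 1−ν₁ < x < 1−mid₁ : rising edge of the reflected tent; 1−x ∈ (mid₁, ν₁) falling edge
    rw [tentT'_lower (θ := θ.reflectJ) (by simp; linarith) (by rw [hm']; exact h2),
      tentT'_upper h (by linarith) (by linarith)]
    simp
  rcases lt_or_gt_of_ne hx2 with h3 | h3
  · -- 1−mid₁ < x < 1−ν₂ : falling edge of the reflected tent; 1−x ∈ (ν₂, mid₁)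
    rw [tentT'_upper (θ := θ.reflectJ) hr (by rw [hm']; exact h2.le) (by simpa using h3),
      tentT'_lower (by linarith) (by linarith)]
    simp
  · -- x > 1−ν₂ : above the reflected tent; 1−x < ν₂
    rw [tentT'_of_hi_le (θ := θ.reflectJ) hr (by simp; linarith), tentT'_of_lt_lo (by linarith)]; simp

/-! ### The polar form does not see a null change of a derivative companion -/

/-- `P(u,v)` is unchanged when the derivative companion `v′` of the second profile is modified on a null set of
`(0,1]` (only `∫u′v̄′`, `∫v′ū′`, `∫v′ū` involve `v′`). [cite: Zhang2022LandauSiegel, §2 (2.17)–(2.18)] -/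
theorem mainTermFormPolar_congr_ae {u u' v v' v'' : ℝ → ℂ}
    (h : ∀ᵐ x ∂volume, x ∈ Ι (0:ℝ) 1 → v' x = v'' x) :
    mainTermFormPolar u u' v v' = mainTermFormPolar u u' v v'' := by
  have e1 : (∫ x in (0:ℝ)..1, u' x * conj (v' x)) = ∫ x in (0:ℝ)..1, u' x * conj (v'' x) :=
    intervalIntegral.integral_congr_ae (h.mono fun x hx hm => by rw [hx hm])
  have e2 : (∫ x in (0:ℝ)..1, v' x * conj (u' x)) = ∫ x in (0:ℝ)..1, v'' x * conj (u' x) :=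
    intervalIntegral.integral_congr_ae (h.mono fun x hx hm => by rw [hx hm])
  have e3 : (∫ x in (0:ℝ)..1, v' x * conj (u x)) = ∫ x in (0:ℝ)..1, v'' x * conj (u x) :=
    intervalIntegral.integral_congr_ae (h.mono fun x hx hm => by rw [hx hm])
  unfold mainTermFormPolar mainTermFormSesq
  rw [e1, e2, e3]

/-! ### The cross functional of record and its two blocks -/

/-- **`𝔡`-block of (10.1)**: formula I on `Θ₁(𝐚₁₁,𝐚₁₃) + conj Θ₁(𝐚₁₃,𝐚₂₁)` = `M(g₁, f) + conj M(f, g₁)`,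
`g₁ = H₁`'s profile, `f = J₁`'s tent ((10.12) + conj (10.13) summed with Prop 7.1's weights).
[cite: Zhang2022LandauSiegel, §10 (10.1), (10.12)–(10.13)] -/
def dSum1S (θ : Theta) : ℂ :=
  Mform (h1Profile θ) (h1Profile' θ) (tentT θ) (tentT' θ)
    + conj (Mform (tentT θ) (tentT' θ) (h1Profile θ) (h1Profile' θ))

/-- **`𝔡′`-block of (10.1)**: formula I on `Θ₁(𝐚₁₄,𝐚₂₂) + conj Θ₁(𝐚₁₂,𝐚₁₄)` = `M(f₂, g₂) + conj M(g₂, f₂)`,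
`g₂ = H₂`'s profile (`𝐚₂₂ = conj 𝐚₁₂`), `f₂ = J₂`'s tent = the tent of `θ.reflectJ` ((10.14) + conj (10.16)).
[cite: Zhang2022LandauSiegel, §10 (10.1), (10.14)–(10.16)] -/
def dSum2S (θ : Theta) : ℂ :=
  Mform (tentT θ.reflectJ) (tentT' θ.reflectJ) (h2Profile θ) (h2Profile' θ)
    + conj (Mform (h2Profile θ) (h2Profile' θ) (tentT θ.reflectJ) (tentT' θ.reflectJ))

/-- **the cross main term of record**: `(𝔡 + 𝔡′)(θ) := dSum1S θ + dSum2S θ` = formula I applied to the four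
`Θ₁`-blocks of (10.1) — `Ξ₁*/(𝔞𝔓)` at main order for the design `θ`. [cite: Zhang2022LandauSiegel, §10 (10.1), (10.17)] -/
def dSumS (θ : Theta) : ℂ := dSum1S θ + dSum2S θ

/-- bounds extracted from the class. [cite: Zhang2022LandauSiegel, §2 (2.21)–(2.28)] -/
private theorem AdmissibleTheta.ks3_bounds (h : AdmissibleTheta θ) :
    0 < θ.nu3 ∧ θ.nu3 < θ.nu2 ∧ θ.nu2 < θ.nu1 ∧ θ.nu1 < 1 ∧ 0 < θ.nu2 := by
  obtain ⟨⟨h32, h21⟩, -, h1, h13, -, -, -⟩ := h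
  unfold Theta.belowP at h1
  unfold Theta.dualRangesNonempty at h13
  exact ⟨by linarith, h32, h21, h1, by linarith⟩

/-- **K-S3, `𝔡`-block: `dSum1S θ = P(g₁, f)`** on the admissible class (Gram identity on the one-sided pair
`g₁`, `f`: `g₁(1) = f(1) = 0`). Hypothesis `hd` of `RepairStructuralBarrierBlocks.not_repairable_true_need_of_blocks`.
[cite: Zhang2022LandauSiegel, §10 (10.1), (10.12)–(10.13), (10.17)] -/
theorem dSum1S_eq_polar (h : AdmissibleTheta θ) :
    dSum1S θ = mainTermFormPolar (h1Profile θ) (h1Profile' θ) (tentT θ) (tentT' θ) := by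
  obtain ⟨h3, h32, h21, h1, h2⟩ := h.ks3_bounds
  have hg := kinkedProfile_h1Profile h
  have hf := kinkedProfile_tentT h21
  have hg1 : h1Profile θ 1 = 0 := by
    unfold h1Profile pairProfile
    rw [kappaP_one (by linarith) h1.le, kappaP_one h2 (by linarith)]; ring
  have hf1 : tentT θ 1 = 0 := tentT_of_hi_le h21 h1.le
  rw [mainTermFormPolar_eq_Mform hg hf hg1 hf1]; rfl

/-- the one-sided Gram identity for the reflected-tent block: `P(f₂, g₂) = dSum2S θ`.
[cite: Zhang2022LandauSiegel, §10 (10.1), (10.14)–(10.16)] -/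
theorem polar_rtent_h2_eq (h : AdmissibleTheta θ) :
    mainTermFormPolar (tentT θ.reflectJ) (tentT' θ.reflectJ) (h2Profile θ) (h2Profile' θ) = dSum2S θ := by
  obtain ⟨h3, h32, h21, h1, h2⟩ := h.ks3_bounds
  have hg := kinkedProfile_h2Profile h
  have hf := kinkedProfile_tentT (reflectJ_lt h21)
  have hg1 : h2Profile θ 1 = 0 := by
    unfold h2Profile pairProfile
    rw [kappaP_one h2 (by linarith), kappaP_one h3 (by linarith)]; ring
  have hf1 : tentT θ.reflectJ 1 = 0 := tentT_of_hi_le (reflectJ_lt h21) (by simp; linarith)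
  rw [mainTermFormPolar_eq_Mform hf hg hf1 hg1]; rfl

/-- **K-S3, `𝔡′`-block: `dSum2S θ = P(R̃g₂, f)`** on the admissible class — the reflected `H₂`-half against
`J₁`'s tent equals formula I on `J₂`'s tent against `H₂` (antiunitarity of `P` under the functional-equation
reflection, `RepairFormReflection.mainTermFormPolar_refl`; the companion `R̃′f′` differs from the reflected tent's
right derivative only on the three kinks). Hypothesis `hdp` of the block assembly.
[cite: Zhang2022LandauSiegel, §10 (10.1), (10.14)–(10.17); §12 (12.6)–(12.8)] -/
theorem dSum2S_eq_polar (h : AdmissibleTheta θ) :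
    dSum2S θ = mainTermFormPolar (reflProfile (h2Profile θ)) (reflDeriv (h2Profile' θ)) (tentT θ) (tentT' θ) := by
  obtain ⟨h3, h32, h21, h1, h2⟩ := h.ks3_bounds
  have hgc : ContinuousOn (h2Profile θ) (Icc 0 1) := (kinkedProfile_h2Profile h).cont
  have hfc : ContinuousOn (tentT θ.reflectJ) (Icc 0 1) := (continuous_tentT _).continuousOn
  -- `P(R̃g₂, R̃f₂)` with the companion `R̃′f₂′`, `f₂ = tentT θ.reflectJ`, `R̃f₂ = tentT θ`
  have hrefl := mainTermFormPolar_refl hgc hfc (h2Profile' θ) (tentT' θ.reflectJ)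
  rw [reflProfile_tentT_reflectJ] at hrefl
  -- replace the companion `R̃′(tentT′ θ.reflectJ)` by `tentT′ θ` (they agree a.e.)
  have hae : ∀ᵐ x ∂volume, x ∈ Ι (0:ℝ) 1 → reflDeriv (tentT' θ.reflectJ) x = tentT' θ x := by
    have h' := reflDeriv_tentT'_ae (reflectJ_lt h21)
    rw [Theta.reflectJ_reflectJ] at h'; exact h'
  rw [mainTermFormPolar_congr_ae hae] at hrefl
  rw [hrefl, ← mainTermFormPolar_swap, polar_rtent_h2_eq h]

/-- **K-S3: the cross main term of record is the polar form on the glued profile**,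
`dSumS θ = P(g₁ + R̃g₂, f)` for every admissible design — hypothesis `hsum` of
`RepairStructuralBarrier.not_repairable_true_need_of_dictionary` with `gl θ = g₁ + R̃g₂`, `fp θ = tentT θ`.
[cite: Zhang2022LandauSiegel, §2 (2.17)–(2.18); §10 (10.1), (10.17)] -/
theorem dSumS_eq_polar (h : AdmissibleTheta θ) :
    dSumS θ = mainTermFormPolar (fun y => h1Profile θ y + reflProfile (h2Profile θ) y)
      (fun y => h1Profile' θ y + reflDeriv (h2Profile' θ) y) (tentT θ) (tentT' θ) := by
  obtain ⟨h3, h32, h21, h1, h2⟩ := h.ks3_bounds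
  rw [polar_add_refl_left (kinkedProfile_h1Profile h).isH1 (kinkedProfile_h2Profile h).isH1 (isH1_tentT h21)]
  unfold dSumS
  rw [dSum1S_eq_polar h, dSum2S_eq_polar h]

/-- **Corollary (the K-S3 + K-S1(J) slots discharged in the block assembly's currency)**: for every admissible
design, `|dSumS θ|² ≤ (𝔅(g₁) + 𝔅(g₂) + 2 Re P(g₁, R̃g₂))·𝔅(f_θ)` — the Cauchy–Schwarz wall with the cross slot
and the `J`-slot instantiated (`RepairGluedForm.norm_sq_dsum_le_blocks`).
[cite: Zhang2022LandauSiegel, §2 (2.18), Props. 2.4–2.6, (2.32)–(2.33)] -/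
theorem norm_sq_dSumS_le_blocks (h : AdmissibleTheta θ) :
    ‖dSumS θ‖ ^ 2 ≤
      (mainTermForm (h1Profile θ) (h1Profile' θ) + mainTermForm (h2Profile θ) (h2Profile' θ)
        + 2 * (mainTermFormPolar (h1Profile θ) (h1Profile' θ)
            (reflProfile (h2Profile θ)) (reflDeriv (h2Profile' θ))).re)
        * mainTermForm (tentT θ) (tentT' θ) := by
  obtain ⟨h3, h32, h21, h1, h2⟩ := h.ks3_bounds
  have := norm_sq_dsum_le_blocks (kinkedProfile_h1Profile h).isH1 (kinkedProfile_h2Profile h).isH1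
    (isH1_tentT h21)
  unfold dSumS
  rw [dSum1S_eq_polar h, dSum2S_eq_polar h]
  exact this

end Repair

end Literature.NumberTheory.LFunctions.Zhang2022
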